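import Literature.NumberTheory.GaloisRepresentations.DiscreteModuleInverseLimitH1
import Literature.NumberTheory.GaloisRepresentations.LocalKummerTorsion
import Literature.NumberTheory.GaloisRepresentations.HomDualValuationSplitting
import Literature.NumberTheory.GaloisRepresentations.LocalGlobalCohomologyFiniteProofs
import HarnessLib

/-!
# The compact Tate dual `T* = Hom(D, μ_{p^∞}) = lim_k Hom(D_k, μ_{p^k})` of an exhausted discrete
# Galois module, as an inverse limit of finite Tate duals

Topic `NumberTheory/GaloisRepresentations`; namespace
`Literature.NumberTheory.GaloisRepresentations.DiscreteGaloisModule.TorsionLayers`. Definitions WITH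
BODIES and theorems; no named fact, no `sorry`, no instance, no notation. Seat `bsd-line-x1-p1-w4`
gen 18 (prover, width seat of cell `bsd-eis`), brick C1 of the road memo «SUR-Λ» (crux
`GoodLatticeBDPValue`, stmt-BirchSwinnertonDyer-19032; target named fact
`Greenberg2016.prop263_sur_of_crk` = Greenberg 2010 Prop. 3.2.1), model (M2) of the road's C1 design
line (bsd-line-x1-p1-w5 gen 9, 2026-08-29).

MATHEMATICS. R. Greenberg, *Surjectivity of the global-to-local map defining a Selmer group*, Kyoto
J. Math. 50 (2010), §2 p. 6: for a discrete `p`-primary `Λ`-module `D` with a continuous Galois action,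
"we can define a `Λ`-module `T* = Hom(D, μ_{p^∞})` … a compact `Λ`-module with a continuous action";
the proofs of Props. 2.1.1, 2.3.2, 3.1.1, 3.2.1 work with the continuous cohomology of `T*` and with
the finite levels `D[𝔪ᵏ]`. This file builds `T*` in the tree's currency as the INVERSE LIMIT of the
finite Tate duals of an exhaustive chain of finite layers:

* `DiscreteGaloisModule.TorsionLayers τ p` — the datum: an increasing exhaustive chain
  `D_0 ≤ D_1 ≤ ⋯ ≤ D` of finite `Γ_K`-stable subgroups with `p^k · D_k = 0` (e.g. `D_k = 𝐃[𝔪ᵏ]`);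
* `E.layerRep k` (`D_k` as a discrete `Γ_K`-module), `E.LayerDual k = TateDual K D_k (p^k)`,
  `E.layerDualRep k = (E.layerRep k).tateDual (p^k)` (the tree's Tate dual, so that the finite-level
  Poitou–Tate theorems apply verbatim), `E.uval f x ∈ K̄ˣ` (values as units), the constructor
  `E.mkLayerDual`;
* `E.dualRes h : Hom(D_m, μ_{p^m}) → Hom(D_n, μ_{p^n})` (`n ≤ m`; restriction, values through
  `μ_{p^n} ⊆ μ_{p^m}`), **`E.dualSystem : DiscreteInvSystem Γ_K E.LayerDual`** (the tree's inverse
  systems of `DiscreteModuleInverseLimit.lean`), with SURJECTIVE transitions (`dualRes_surjective`: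
  `K̄ˣ` is an injective `ℤ`-module, the tree's `HomDual.baer_unitsCarrier`), FINITE levels
  (`finite_layerDual`) and the cofinal chain `E.chain` — exactly the hypotheses of the tree's
  `DiscreteInvSystem.continuousCohomologyOneLimitEquiv` (NSW (2.7.5): `H¹_cont(Γ, lim) ≅ lim H¹`);
* **`T* := E.dualSystem.limitRep`** (compact, jointly continuous `Γ_K`-action) and the evaluation
  **`E.evalDual : T* →+ (D →+ K̄ˣ)`**, `x ↦ (d ↦ x(d))`, BIJECTIVE onto `Hom(D, K̄ˣ)`
  (`evalDual_bijective`; `= Hom(D, μ_{p^∞})`, `D` being `p`-power torsion), with the equivariance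
  `(σx)(d) = σ·x(σ⁻¹d)` (`evalDual_limitRep`) and the fixed-point criterion
  `σ x = x ↔ ∀ d, x(σ d) = σ·x(d)` (`limitRep_apply_eq_self_iff` — the shape of the Greenberg
  dictionary's `LOC1` / `tateDualInvariants`, which quantify over additive maps `D → K̄ˣ`).
The scalars of `Λ` (`(θ·x)(d) = x(θ d)`), the `Λ`-module structure, and the degree-`1` comparison
`H¹_cont(Γ_K, T*) ≃ lim_k H¹(Γ_K, Hom(D_k, μ_{p^k}))` (global and along `Γ_{K_v} → Γ_K`) are in the
sequel `PontryaginTateDualInverseLimitScalars.lean`.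

Design notes. (i) `τ` is `ℤ`-linear (`DiscreteGaloisModule K D`, the currency of the tree's Galois
cohomology and Poitou–Tate files); a `Λ`-structure enters only through endomorphisms of `D`
preserving the layers (sequel). (ii) Number fields are not needed: `K` is any field (for the intended
`p`-primary `D` one wants `char K ≠ p`, used nowhere here). (iii) Universe `Type` (= the universe of
the consumers `Greenberg2016.prop263_sur_of_crk`, `HomDual.baer_unitsCarrier`).

HONESTY. Infrastructure only; nothing here proves a statement of Greenberg's papers or any summit
statement; BSD is not advanced. AI-typed, kernel-checked.

## References
* R. Greenberg, *Surjectivity of the global-to-local map defining a Selmer group*, Kyoto J. Math. 50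
  (2010) 853–888, §2 p. 6 L1–12 (`T*`), Prop. 2.1.1 (pp. 7–8). [Greenberg2010]
* J. Neukirch, A. Schmidt, K. Wingberg, *Cohomology of Number Fields*, 2nd ed. (2008), II §7
  Thm. (2.7.5). [NeukirchSchmidtWingberg2008]
* J. S. Milne, *Arithmetic Duality Theorems*, 2nd ed. (2006), I §0, I §2 (`M^D = Hom(M, μ)`). [MilneADT2006]
-/

noncomputable section

open Function CategoryTheory
open _root_.TopRep _root_.ContRepresentation _root_.ContinuousCohomology
open Literature.NumberTheory.GaloisRepresentations.DiscreteGaloisModule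
namespace Literature.NumberTheory.GaloisRepresentations

variable {K : Type} [Field K] {D : Type} [AddCommGroup D] [TopologicalSpace D] [DiscreteTopology D]

/-- **Torsion layers of a discrete Galois module**: an increasing, exhaustive chain
`D_0 ≤ D_1 ≤ ⋯` of finite `Γ_K`-stable subgroups of the discrete `Γ_K`-module `D` with
`p^k · D_k = 0` (e.g. `D_k = 𝐃[𝔪ᵏ]` for a cofinitely generated discrete `Λ`-module `𝐃` over a complete
Noetherian local `ℤ_p`-algebra `Λ` with maximal ideal `𝔪`, Greenberg 2010 §2; or `D_k = A[p^k]` for a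
`p`-primary abelian group of finite corank). The datum from which the compact dual
`T* = Hom(D, μ_{p^∞}) = lim_k Hom(D_k, μ_{p^k})` is assembled.
[cite: Greenberg2010, §2 p. 6 L1–12 (`T* = Hom(D, μ_{p^∞})`, compact `Λ`-module)] -/
structure DiscreteGaloisModule.TorsionLayers (τ : DiscreteGaloisModule K D) (p : ℕ) where
  /-- the layers `D_k` -/
  N : ℕ → Submodule ℤ D
  /-- the chain is increasing -/
  mono : Monotone N
  /-- each layer is `Γ_K`-stable -/
  stable : ∀ (k : ℕ) (σ : Field.absoluteGaloisGroup K), N k ≤ (N k).comap (τ σ)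
  /-- `p^k` kills `D_k` -/
  torsion : ∀ (k : ℕ), ∀ d ∈ N k, (p ^ k) • d = 0
  /-- each layer is finite -/
  finite : ∀ k : ℕ, Finite (N k)
  /-- the chain exhausts `D` -/
  exhaustive : ∀ d : D, ∃ k : ℕ, d ∈ N k

namespace DiscreteGaloisModule.TorsionLayers

variable {τ : DiscreteGaloisModule K D} {p : ℕ} (E : τ.TorsionLayers p)

/-! ### The layers and their Tate duals -/

/-- The layer `D_k` as a (finite) discrete `Γ_K`-module. [cite: Greenberg2010, §2 p. 6 L1–12] -/
def layerRep (k : ℕ) : DiscreteGaloisModule K (E.N k) :=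
  τ.subrepresentation (E.N k) (E.stable k)

/-- Unfolding: `Γ_K` acts on `D_k` by restriction of `τ`. [cite: Greenberg2010, §2 p. 6 L1–12] -/
@[simp] theorem layerRep_apply_coe (k : ℕ) (σ : Field.absoluteGaloisGroup K) (x : E.N k) :
    ((E.layerRep k σ x : E.N k) : D) = τ σ (x : D) := rfl

/-- The Tate dual `D_k^D = Hom(D_k, μ_{p^k})` of the `k`-th layer (carrier: the tree's `TateDual`).
[cite: Greenberg2010, §2 p. 6 L1–12] -/
abbrev LayerDual (k : ℕ) : Type := TateDual K (E.N k) (p ^ k)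

/-- The Tate dual `D_k^D = Hom(D_k, μ_{p^k})` as a discrete `Γ_K`-module, `(σ f)(m) = σ f(σ⁻¹ m)`
(the tree's `DiscreteGaloisModule.tateDual`). [cite: Greenberg2010, §2 p. 6 L1–12] -/
def layerDualRep (k : ℕ) : DiscreteGaloisModule K (E.LayerDual k) :=
  haveI := E.finite k
  (E.layerRep k).tateDual (p ^ k)

/-- Unfolding the action on `D_k^D`. [cite: Greenberg2010, §2 p. 6 L1–12] -/
theorem layerDualRep_apply_apply (k : ℕ) (σ : Field.absoluteGaloisGroup K)
    (f : E.LayerDual k) (x : E.N k) :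
    E.layerDualRep k σ f x = mu K (p ^ k) σ (f (E.layerRep k σ⁻¹ x)) := rfl

/-- `p^k · x = 0` in the layer `D_k`. [cite: Greenberg2010, §2 p. 6 L1–12] -/
theorem pow_smul_eq_zero {k : ℕ} (x : E.N k) : (p ^ k) • x = 0 :=
  Subtype.ext (by simpa using E.torsion k x x.2)

/-- The inclusion of layers `D_n ≤ D_m` (`n ≤ m`). [cite: Greenberg2010, §2 p. 6 L1–12] -/
abbrev incl {n m : ℕ} (h : n ≤ m) : E.N n →ₗ[ℤ] E.N m := Submodule.inclusion (E.mono h)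

/-! ### Values of dual elements as units of `K̄` -/

/-- The unit of `K̄` underlying the value `f(x) ∈ μ_{p^k}(K̄)` of `f ∈ Hom(D_k, μ_{p^k})`.
[cite: Greenberg2010, §2 p. 6 L1–12] -/
def uval {k : ℕ} (f : E.LayerDual k) (x : E.N k) : (AlgebraicClosure K)ˣ :=
  ((Additive.toMul (f x) : rootsOfUnity (p ^ k) (AlgebraicClosure K)) : (AlgebraicClosure K)ˣ)

/-- `uval` is additive in `f`. [cite: Greenberg2010, §2 p. 6 L1–12] -/
@[simp] theorem uval_add {k : ℕ} (f g : E.LayerDual k) (x : E.N k) :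
    E.uval (f + g) x = E.uval f x * E.uval g x := rfl

/-- `uval 0 = 1`. [cite: Greenberg2010, §2 p. 6 L1–12] -/
@[simp] theorem uval_zero {k : ℕ} (x : E.N k) : E.uval (0 : E.LayerDual k) x = 1 := rfl

/-- `uval` is additive in `x`. [cite: Greenberg2010, §2 p. 6 L1–12] -/
theorem uval_map_add {k : ℕ} (f : E.LayerDual k) (x y : E.N k) :
    E.uval f (x + y) = E.uval f x * E.uval f y := by
  simp only [uval, map_add, toMul_add, Subgroup.coe_mul]

/-- `uval f 0 = 1`. [cite: Greenberg2010, §2 p. 6 L1–12] -/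
@[simp] theorem uval_map_zero {k : ℕ} (f : E.LayerDual k) : E.uval f 0 = 1 := by
  simp only [uval, map_zero, toMul_zero, Subgroup.coe_one]

/-- `uval f (c • x) = (uval f x) ^ c`. [cite: Greenberg2010, §2 p. 6 L1–12] -/
theorem uval_map_nsmul {k : ℕ} (f : E.LayerDual k) (c : ℕ) (x : E.N k) :
    E.uval f (c • x) = E.uval f x ^ c := by
  simp only [uval, map_nsmul, toMul_nsmul, SubgroupClass.coe_pow]

/-- The values of `f ∈ Hom(D_k, μ_{p^k})` are `p^k`-th roots of unity. [cite: Greenberg2010, §2 p. 6 L1–12] -/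
theorem uval_pow_eq_one {k : ℕ} (f : E.LayerDual k) (x : E.N k) : E.uval f x ^ (p ^ k) = 1 :=
  (mem_rootsOfUnity _ _).1 (Additive.toMul (f x)).2

/-- Two dual elements with the same unit values are equal. [cite: Greenberg2010, §2 p. 6 L1–12] -/
theorem ext_uval {k : ℕ} {f g : E.LayerDual k} (h : ∀ x, E.uval f x = E.uval g x) : f = g :=
  TateDual.ext fun x => Additive.toMul.injective (Subtype.ext (h x))

/-- The Galois action read on unit values: `(σ f)(x) = σ · f(σ⁻¹ x)`. [cite: Greenberg2010, §2 p. 6 L1–12] -/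
theorem uval_layerDualRep {k : ℕ} (σ : Field.absoluteGaloisGroup K) (f : E.LayerDual k) (x : E.N k) :
    E.uval (E.layerDualRep k σ f) x = σ • E.uval f (E.layerRep k σ⁻¹ x) := rfl

/-- **Constructor**: a multiplicative map `u : D_k → K̄ˣ` with values in `μ_{p^k}` as an element of
`Hom(D_k, μ_{p^k})`. [cite: Greenberg2010, §2 p. 6 L1–12] -/
def mkLayerDual {k : ℕ} (u : E.N k → (AlgebraicClosure K)ˣ) (hu : ∀ x, u x ^ (p ^ k) = 1)
    (hadd : ∀ x y, u (x + y) = u x * u y) : E.LayerDual k :=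
  show E.N k →+ Additive (rootsOfUnity (p ^ k) (AlgebraicClosure K)) from
  { toFun := fun x => Additive.ofMul ⟨u x, (mem_rootsOfUnity _ _).2 (hu x)⟩
    map_zero' := by
      have h0 : u 0 = 1 := by
        have := hadd 0 0
        rw [add_zero] at this
        exact left_eq_mul.1 this
      exact congrArg Additive.ofMul (Subtype.ext h0)
    map_add' := fun x y => congrArg Additive.ofMul (Subtype.ext (hadd x y)) }

/-- Unit values of the constructor. [cite: Greenberg2010, §2 p. 6 L1–12] -/
@[simp] theorem uval_mkLayerDual {k : ℕ} (u : E.N k → (AlgebraicClosure K)ˣ)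
    (hu : ∀ x, u x ^ (p ^ k) = 1) (hadd : ∀ x y, u (x + y) = u x * u y) (x : E.N k) :
    E.uval (E.mkLayerDual u hu hadd) x = u x := rfl

/-! ### The transition maps and the inverse system -/

/-- A value `f(x)`, `f ∈ Hom(D_m, μ_{p^m})`, `x ∈ D_n`, is a `p^n`-th root of unity.
[cite: Greenberg2010, §2 p. 6 L1–12] -/
theorem uval_incl_pow_eq_one {n m : ℕ} (h : n ≤ m) (f : E.LayerDual m) (x : E.N n) :
    E.uval f (E.incl h x) ^ (p ^ n) = 1 := by
  rw [← uval_map_nsmul, ← map_nsmul, E.pow_smul_eq_zero, map_zero, uval_map_zero]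

/-- **The transition map `Hom(D_m, μ_{p^m}) → Hom(D_n, μ_{p^n})`** (`n ≤ m`): restrict to `D_n`; the
values lie in `μ_{p^n} ⊆ μ_{p^m}` because `p^n · D_n = 0`. [cite: Greenberg2010, §2 p. 6 L1–12] -/
def dualRes {n m : ℕ} (h : n ≤ m) : E.LayerDual m →+ E.LayerDual n where
  toFun f := E.mkLayerDual (fun x => E.uval f (E.incl h x)) (E.uval_incl_pow_eq_one h f)
    fun x y => by rw [map_add, uval_map_add]
  map_zero' := E.ext_uval fun x => by rw [uval_mkLayerDual, uval_zero, uval_zero]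
  map_add' f g := E.ext_uval fun x => by rw [uval_mkLayerDual, uval_add, uval_add, uval_mkLayerDual,
    uval_mkLayerDual]

/-- Unit values of the transition map: `(res f)(x) = f(x)`. [cite: Greenberg2010, §2 p. 6 L1–12] -/
@[simp] theorem uval_dualRes {n m : ℕ} (h : n ≤ m) (f : E.LayerDual m) (x : E.N n) :
    E.uval (E.dualRes h f) x = E.uval f (E.incl h x) := rfl

/-- **The inverse system `(Hom(D_k, μ_{p^k}))_k` of finite discrete `Γ_K`-modules** (the tree's
`DiscreteInvSystem` over `ℕ` with `≤`). [cite: Greenberg2010, §2 p. 6 L1–12] -/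
def dualSystem : DiscreteInvSystem (Field.absoluteGaloisGroup K) E.LayerDual where
  le := (· ≤ ·)
  le_refl := le_refl
  le_trans := fun h₁ h₂ => h₁.trans h₂
  ρ := fun k => E.layerDualRep k
  red := fun h => E.dualRes h
  red_smul := fun {n m} h σ f => E.ext_uval fun x => by
    rw [uval_dualRes, uval_layerDualRep, uval_layerDualRep, uval_dualRes]
    rfl
  red_refl := fun n f => E.ext_uval fun x => by
    rw [uval_dualRes]
    rfl
  red_trans := fun {a b c} h₁ h₂ f => E.ext_uval fun x => by
    rw [uval_dualRes, uval_dualRes, uval_dualRes]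
    rfl

/-- Unfolding: the order of `dualSystem` is `≤` on `ℕ`. [cite: Greenberg2010, §2 p. 6 L1–12] -/
theorem dualSystem_le (n m : ℕ) : E.dualSystem.le n m ↔ n ≤ m := Iff.rfl

/-- Unfolding: the modules of `dualSystem`. [cite: Greenberg2010, §2 p. 6 L1–12] -/
@[simp] theorem dualSystem_ρ (k : ℕ) : E.dualSystem.ρ k = E.layerDualRep k := rfl

/-- Unfolding: the transition maps of `dualSystem`. [cite: Greenberg2010, §2 p. 6 L1–12] -/
@[simp] theorem dualSystem_red {n m : ℕ} (h : n ≤ m) (f : E.LayerDual m) :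
    E.dualSystem.red h f = E.dualRes h f := rfl


/-- The transition maps of `dualSystem` are **surjective**: a homomorphism `D_n → μ_{p^n} ⊆ K̄ˣ`
extends to `D_m → K̄ˣ` because `K̄ˣ` is divisible (an injective `ℤ`-module, the tree's
`HomDual.baer_unitsCarrier`), and the extension takes values in `μ_{p^m}` since `p^m · D_m = 0`.
(This is the hypothesis `hs` of the tree's `DiscreteInvSystem.continuousCohomologyOneLimitEquiv`.)
[cite: Greenberg2010, §2 p. 6 L1–12] -/
theorem dualRes_surjective {n m : ℕ} (h : n ≤ m) : Surjective (E.dualRes h) := by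
  intro g
  -- the `K̄ˣ`-valued shadow of `g`, extended to `D_m`
  let G : E.N n →+ UnitsCarrier K :=
    { toFun := fun x => UnitsCarrier.ofUnits (E.uval g x)
      map_zero' := by rw [uval_map_zero]; rfl
      map_add' := fun x y => by rw [uval_map_add]; rfl }
  obtain ⟨G', hG'⟩ := (HomDual.baer_unitsCarrier K).extension_property_addMonoidHom
    (E.incl h).toAddMonoidHom (Submodule.inclusion_injective (E.mono h)) G
  have hG'pow : ∀ y : E.N m, unitsVal K (G' y) ^ (p ^ m) = 1 := fun y => by
    rw [← zpow_natCast, ← unitsVal_zsmul, natCast_zsmul, ← map_nsmul, E.pow_smul_eq_zero, map_zero]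
    rfl
  refine ⟨E.mkLayerDual (fun y => unitsVal K (G' y)) hG'pow fun x y => by rw [map_add, unitsVal_add],
    E.ext_uval fun x => ?_⟩
  rw [uval_dualRes, uval_mkLayerDual]
  have hx := DFunLike.congr_fun hG' x
  rw [AddMonoidHom.comp_apply] at hx
  change unitsVal K (G' (E.incl h x)) = _
  rw [show (E.incl h x) = (E.incl h).toAddMonoidHom x from rfl, hx]
  rfl

/-- The layers' duals are finite (`p ≠ 0`). (The hypothesis `hfin` of
`DiscreteInvSystem.continuousCohomologyOneLimitEquiv`.) [cite: Greenberg2010, §2 p. 6 L1–12] -/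
theorem finite_layerDual [NeZero p] (k : ℕ) : Finite (E.LayerDual k) := by
  haveI := E.finite k
  haveI : NeZero (p ^ k) := ⟨pow_ne_zero k (NeZero.ne p)⟩
  exact DiscreteGaloisModule.TateDual.finite K (E.N k) (p ^ k)

/-- The identity of `ℕ` is a cofinal chain of `dualSystem`. [cite: Greenberg2010, §2 p. 6 L1–12] -/
def chain : E.dualSystem.CofinalChain where
  seq := id
  le_succ := fun i => Nat.le_succ i
  cofinal := fun n => ⟨n, le_refl n⟩

/-! ### The compact dual `T* = lim_k Hom(D_k, μ_{p^k})` and its evaluation on `D` -/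

/-- Coordinates of an element of `T* = lim_k Hom(D_k, μ_{p^k})` are compatible.
[cite: Greenberg2010, §2 p. 6 L1–12] -/
theorem dualRes_coord (x : E.dualSystem.limit) {n m : ℕ} (h : n ≤ m) :
    E.dualRes h ((x : ∀ k, E.LayerDual k) m) = (x : ∀ k, E.LayerDual k) n :=
  E.dualSystem.red_apply_coe x h

/-- Unit values along the limit are independent of the level. [cite: Greenberg2010, §2 p. 6 L1–12] -/
theorem uval_coord_eq_of_le (x : E.dualSystem.limit) {d : D} {n m : ℕ} (h : n ≤ m) (hn : d ∈ E.N n)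
    (hm : d ∈ E.N m) :
    E.uval ((x : ∀ k, E.LayerDual k) n) ⟨d, hn⟩ = E.uval ((x : ∀ k, E.LayerDual k) m) ⟨d, hm⟩ := by
  rw [← E.dualRes_coord x h, uval_dualRes]
  rfl

/-- Unit values along the limit are independent of the level (any two levels).
[cite: Greenberg2010, §2 p. 6 L1–12] -/
theorem uval_coord_eq (x : E.dualSystem.limit) {d : D} {n m : ℕ} (hn : d ∈ E.N n) (hm : d ∈ E.N m) :
    E.uval ((x : ∀ k, E.LayerDual k) n) ⟨d, hn⟩ = E.uval ((x : ∀ k, E.LayerDual k) m) ⟨d, hm⟩ := by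
  rcases le_total n m with h | h
  · exact E.uval_coord_eq_of_le x h hn hm
  · exact (E.uval_coord_eq_of_le x h hm hn).symm

/-- A chosen level containing `d`. [cite: Greenberg2010, §2 p. 6 L1–12] -/
def level (d : D) : ℕ := (E.exhaustive d).choose

/-- The chosen level contains `d`. [cite: Greenberg2010, §2 p. 6 L1–12] -/
theorem mem_level (d : D) : d ∈ E.N (E.level d) := (E.exhaustive d).choose_spec

/-- The unit value `x(d) ∈ K̄ˣ` of `x ∈ T*` at `d ∈ D`, read at the chosen level.
[cite: Greenberg2010, §2 p. 6 L1–12] -/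
def evalUnit (x : E.dualSystem.limit) (d : D) : (AlgebraicClosure K)ˣ :=
  E.uval ((x : ∀ k, E.LayerDual k) (E.level d)) ⟨d, E.mem_level d⟩

/-- `x(d)` may be read at any level containing `d`. [cite: Greenberg2010, §2 p. 6 L1–12] -/
theorem evalUnit_eq (x : E.dualSystem.limit) {d : D} {k : ℕ} (hk : d ∈ E.N k) :
    E.evalUnit x d = E.uval ((x : ∀ k, E.LayerDual k) k) ⟨d, hk⟩ :=
  E.uval_coord_eq x _ _

/-- `x ↦ x(d)` is additive in `x`. [cite: Greenberg2010, §2 p. 6 L1–12] -/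
theorem evalUnit_add (x y : E.dualSystem.limit) (d : D) :
    E.evalUnit (x + y) d = E.evalUnit x d * E.evalUnit y d := by
  simp only [evalUnit, AddSubgroup.coe_add, Pi.add_apply, uval_add]

/-- `d ↦ x(d)` is additive in `d`. [cite: Greenberg2010, §2 p. 6 L1–12] -/
theorem evalUnit_map_add (x : E.dualSystem.limit) (d d' : D) :
    E.evalUnit x (d + d') = E.evalUnit x d * E.evalUnit x d' := by
  obtain ⟨k, hk⟩ := E.exhaustive d
  obtain ⟨k', hk'⟩ := E.exhaustive d'
  have hd : d ∈ E.N (max k k') := E.mono (le_max_left k k') hk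
  have hd' : d' ∈ E.N (max k k') := E.mono (le_max_right k k') hk'
  rw [E.evalUnit_eq x hd, E.evalUnit_eq x hd', E.evalUnit_eq x ((E.N (max k k')).add_mem hd hd'),
    ← uval_map_add]
  rfl

/-- **The evaluation `T* → Hom(D, K̄ˣ)`, `x ↦ (d ↦ x(d))`** — the Pontryagin/Tate pairing of
`T* = lim_k Hom(D_k, μ_{p^k})` with `D = ⋃_k D_k`, valued in `μ_{p^∞} ⊆ K̄ˣ` (the tree's
`DiscreteGaloisModule.UnitsCarrier K`). [cite: Greenberg2010, §2 p. 6 L1–12] -/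
def evalDual : E.dualSystem.limit →+ (D →+ UnitsCarrier K) where
  toFun x :=
    { toFun := fun d => UnitsCarrier.ofUnits (E.evalUnit x d)
      map_zero' := by
        rw [E.evalUnit_eq x (E.N 0).zero_mem]
        exact congrArg UnitsCarrier.ofUnits (E.uval_map_zero _)
      map_add' := fun d d' => by rw [evalUnit_map_add]; rfl }
  map_zero' := by
    ext d
    change UnitsCarrier.ofUnits (E.evalUnit 0 d) = 0
    rw [evalUnit]
    rfl
  map_add' x y := by
    ext d
    change UnitsCarrier.ofUnits (E.evalUnit (x + y) d) =
      UnitsCarrier.ofUnits (E.evalUnit x d) + UnitsCarrier.ofUnits (E.evalUnit y d)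
    rw [evalUnit_add]
    rfl

/-- Unfolding `evalDual` through `unitsVal`: `evalDual x d = x_k(d)` at any level `k ∋ d`.
[cite: Greenberg2010, §2 p. 6 L1–12] -/
theorem unitsVal_evalDual_apply (x : E.dualSystem.limit) {d : D} {k : ℕ} (hk : d ∈ E.N k) :
    unitsVal K (E.evalDual x d) = E.uval ((x : ∀ k, E.LayerDual k) k) ⟨d, hk⟩ :=
  E.evalUnit_eq x hk

/-- `evalDual x` restricted to `D_k` has the unit values of the `k`-th coordinate.
[cite: Greenberg2010, §2 p. 6 L1–12] -/
theorem unitsVal_evalDual_coe (x : E.dualSystem.limit) {k : ℕ} (m : E.N k) :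
    unitsVal K (E.evalDual x m) = E.uval ((x : ∀ k, E.LayerDual k) k) m :=
  E.evalUnit_eq x m.2

/-- **`evalDual` is injective**: an element of `T*` is determined by its values on `D`.
[cite: Greenberg2010, §2 p. 6 L1–12] -/
theorem evalDual_injective : Injective E.evalDual := by
  intro x y hxy
  refine Subtype.ext (funext fun k => E.ext_uval fun m => ?_)
  rw [← unitsVal_evalDual_coe, ← unitsVal_evalDual_coe, hxy]

/-- The level-`k` dual element cut out by an additive `F : D → K̄ˣ` (its values on `D_k` are
`p^k`-th roots of unity since `p^k · D_k = 0`). [cite: Greenberg2010, §2 p. 6 L1–12] -/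
def ofHomLayer (F : D →+ UnitsCarrier K) (k : ℕ) : E.LayerDual k :=
  E.mkLayerDual (fun m => unitsVal K (F m))
    (fun m => by
      rw [← zpow_natCast, ← unitsVal_zsmul, natCast_zsmul, ← map_nsmul, E.torsion k m m.2, map_zero]
      rfl)
    fun m m' => by rw [Submodule.coe_add, map_add, unitsVal_add]

/-- Unit values of `ofHomLayer`. [cite: Greenberg2010, §2 p. 6 L1–12] -/
@[simp] theorem uval_ofHomLayer (F : D →+ UnitsCarrier K) (k : ℕ) (m : E.N k) :
    E.uval (E.ofHomLayer F k) m = unitsVal K (F m) := rfl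

/-- The element of `T*` cut out by an additive `F : D → K̄ˣ`. [cite: Greenberg2010, §2 p. 6 L1–12] -/
def ofHom (F : D →+ UnitsCarrier K) : E.dualSystem.limit :=
  ⟨fun k => E.ofHomLayer F k, fun n m h => E.ext_uval fun x => by
    rw [dualSystem_red, uval_dualRes, uval_ofHomLayer, uval_ofHomLayer]
    rfl⟩

/-- `evalDual (ofHom F) = F`. [cite: Greenberg2010, §2 p. 6 L1–12] -/
theorem evalDual_ofHom (F : D →+ UnitsCarrier K) : E.evalDual (E.ofHom F) = F := by
  ext d
  apply unitsVal_injective K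
  rw [E.unitsVal_evalDual_apply _ (E.mem_level d)]
  rfl

/-- **`evalDual` is surjective** onto all of `Hom(D, K̄ˣ)` (`= Hom(D, μ_{p^∞})`, `D` being
`p`-power torsion). [cite: Greenberg2010, §2 p. 6 L1–12] -/
theorem evalDual_surjective : Surjective E.evalDual := fun F => ⟨E.ofHom F, E.evalDual_ofHom F⟩

/-- **`T* ≃ Hom(D, K̄ˣ)`**: `evalDual` is bijective. [cite: Greenberg2010, §2 p. 6 L1–12] -/
theorem evalDual_bijective : Bijective E.evalDual := ⟨E.evalDual_injective, E.evalDual_surjective⟩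

/-! ### The Galois action on `T*` read through `evalDual` -/

/-- **Equivariance of the evaluation**: `(σ x)(d) = σ · x(σ⁻¹ d)`. [cite: Greenberg2010, §2 p. 6 L1–12] -/
theorem evalDual_limitRep (σ : Field.absoluteGaloisGroup K) (x : E.dualSystem.limit) (d : D) :
    E.evalDual (E.dualSystem.limitRep σ x) d = units K σ (E.evalDual x (τ σ⁻¹ d)) := by
  obtain ⟨k, hk⟩ := E.exhaustive d
  have hk' : τ σ⁻¹ d ∈ E.N k := E.stable k σ⁻¹ hk
  apply unitsVal_injective K
  rw [E.unitsVal_evalDual_apply _ hk, unitsVal_apply, E.unitsVal_evalDual_apply _ hk',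
    DiscreteInvSystem.coe_limitRep_apply, dualSystem_ρ, uval_layerDualRep]
  rfl

/-- **Fixed vectors of `T*` are the equivariant maps**: `σ x = x` iff `x(σ d) = σ · x(d)` for all
`d ∈ D` (so `(T*)^{G} = Hom_G(D, K̄ˣ)`, the shape of the dictionary's `LOC1` / `tateDualInvariants`).
[cite: Greenberg2010, §2 p. 6 L1–12; Prop. 2.1.1 (p. 7)] -/
theorem limitRep_apply_eq_self_iff (σ : Field.absoluteGaloisGroup K) (x : E.dualSystem.limit) :
    E.dualSystem.limitRep σ x = x ↔ ∀ d : D, E.evalDual x (τ σ d) = units K σ (E.evalDual x d) := by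
  constructor
  · intro h d
    have := E.evalDual_limitRep σ x (τ σ d)
    rw [h, ← Module.End.mul_apply, ← map_mul, inv_mul_cancel, map_one, Module.End.one_apply] at this
    exact this
  · intro h
    apply E.evalDual_injective
    ext d
    rw [evalDual_limitRep, ← h (τ σ⁻¹ d), ← Module.End.mul_apply, ← map_mul, mul_inv_cancel, map_one,
      Module.End.one_apply]

end DiscreteGaloisModule.TorsionLayers

end Literature.NumberTheory.GaloisRepresentations

end
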